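import Summits.ResolutionOfSingularities.ResolutionOfSingularities.Theorems.EquisingularLiftEquisingularLiftNatEquinodalCoreSOfCores
import Summits.ResolutionOfSingularities.ResolutionOfSingularities.Theorems.EquisingularLiftEquisingularLiftNatEquinodalHyperplaneLift
import Summits.ResolutionOfSingularities.ResolutionOfSingularities.Theorems.EquisingularLiftEquisingularLiftNatEquinodalHyperplaneAlg
import HarnessLib

/-!
# [OURS · L1 W4.5(b) · EL♮(3) · door ν4, brick N-0, core S8 — the LINEAR FRAME at a node section] ★ `SectionFrame.span_X_sub_eq_span_frame`:
# in `O[x₀..x₃]`, the ideal of the `O`-point `[a]` (`a = av i`, `a d = 1`) spanned by the `x_j − a_j x_d` EQUALS the ideal spanned by the frame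
# `{L̃, y₀ − n₀ y₂, y₁ − n₁ y₂}` (`L̃` the lifted hyperplane, `y_t = Σ_j Ñ_{tj} x_{r j}` the hyperplane coordinates, `n = nO i`, `n₂ = 1`)

res-L1-w45b-stub-4 g13 (desk WORD g25-5/g25-6: core S8 `SplitNodeAt`; this is its piece (γ) «`𝓢ₓ = 𝓛₀ₓ ⊔ (u, v)`» at the level of homogeneous ideals —
with ✓ `SectionOfVec.stalkIdeal_ker_sectionOfVec_eq` (p686535) it gives the stalk equation).  DEF-FREE; no `sorry`; standard axioms.  `--supports
stmt-ResolutionOfSingularities-20148 --as helper`, counted 0.  EL♮(3) is NOT proved; resolution of singularities in positive characteristic is NOT proved.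

HYPOTHESES = the `cores₂` binders they come from (✓ `coreS_of_cores₂`): `ct a₀ = 1`, `ψ̃ L̃ = 0`, `ψ̃ ∘ σ̃ = id`, `ker ψ̃ = (L̃)`
(`ψ̃ = aeval (x_a ↦ Σ_j B̃_{aj} X_j)`, `σ̃ = aeval (Y_t ↦ y_t)`), `n₂ = 1`, `a d = 1`, `u · a = B̃ · n` with `u` a unit; `O` a domain (a DVR in `cores₂`).
PROOF.  `⊇`: a linear form `Σ c_i x_{v i}` vanishing at `a` is `Σ c_i (x_{v i} − a_{v i} x_d)` (`sum_C_mul_X_mem_span_of_eval`); the three frame forms vanish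
at `a` because `u · ℓ(a) = (ψ̃ ℓ)(n)` and `ψ̃ L̃ = 0`, `ψ̃ y_t = Y_t`.  `⊆`: for `m = x_j − a_j x_d`, `ψ̃ m` is a linear form in `Y` vanishing at `n`, hence
`= β (Y₀ − n₀Y₂) + γ (Y₁ − n₁Y₂)`; so `T := m − β m₀ − γ m₁ − α L̃` (`α` its `x_{a₀}`-coefficient) is linear with `ψ̃ T = 0`, `L̃ ∣ T` and `x_{a₀}`-coefficient `0`,
whence `T = 0` by ✓ `HyperplaneLift.eq_zero_of_dvd_of_isHomogeneous_one` (domain). [folklore linear algebra]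
-/

set_option linter.dupNamespace false -- mandated namespace `Summit.<Summit>.<Problem>` of this single-conjunct summit

noncomputable section

open MvPolynomial

namespace Summit.ResolutionOfSingularities.ResolutionOfSingularities.Cruxes.EquisingularLiftNat.Sections.Equinodal.SectionFrame

variable {O : Type} [CommRing O]

/-- `⊇`, generic: a linear form `Σ_i c_i x_{v i}` with `Σ_i c_i a_{v i} = 0` lies in the ideal `(x_j − a_j x_d)_j` — indeed it equals
`Σ_i c_i (x_{v i} − a_{v i} x_d)` when `a d = 1` is not even needed. [folklore] -/
theorem sum_C_mul_X_mem_span_of_eval {ι : Type*} [Fintype ι] (c : ι → O) (v : ι → Fin (3 + 1)) (a : Fin (3 + 1) → O) (d : Fin (3 + 1))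
    (h : ∑ i, c i * a (v i) = 0) :
    (∑ i, C (c i) * X (v i) : MvPolynomial (Fin (3 + 1)) O) ∈ Ideal.span (Set.range fun j : Fin (3 + 1) => (X j - C (a j) * X d : MvPolynomial (Fin (3 + 1)) O)) := by
  have hid : (∑ i, C (c i) * X (v i) : MvPolynomial (Fin (3 + 1)) O) =
      ∑ i, C (c i) * (X (v i) - C (a (v i)) * X d) + C (∑ i, c i * a (v i)) * X d := by
    rw [map_sum, Finset.sum_mul, ← Finset.sum_add_distrib]
    refine Finset.sum_congr rfl fun i _ => ?_
    rw [map_mul]; ring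
  rw [hid, h, C_0, zero_mul, add_zero]
  exact Ideal.sum_mem _ fun i _ => Ideal.mul_mem_left _ _ (Ideal.subset_span ⟨v i, rfl⟩)

/-- evaluation through the hyperplane frame: `u^m · F(a) = (ψ̃ F)(n)` for a form `F` of degree `m` when `u · a = B̃ · n`. [folklore] -/
theorem pow_mul_eval_eq_eval_aeval (Bt : Fin (3 + 1) → Fin 3 → O) (nO : Fin 3 → O) (av : Fin (3 + 1) → O) (u : O)
    (huav : ∀ a', u * av a' = ∑ j : Fin 3, Bt a' j * nO j) {m : ℕ} (F : MvPolynomial (Fin (3 + 1)) O)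
    (hF : F ∈ homogeneousSubmodule (Fin (3 + 1)) O m) :
    u ^ m * MvPolynomial.eval av F = MvPolynomial.eval nO (aeval (fun a' : Fin (3 + 1) => ∑ j : Fin 3, C (Bt a' j) * X j) F) := by
  rw [eval_aeval_linear, ← eval_smul_of_mem_homogeneousSubmodule F hF u av]
  exact congrArg (fun t => MvPolynomial.eval t F) (funext huav)

/-- the hyperplane coordinates evaluate to `n` along the section: `u · y_t(a) = n_t` (`ψ̃ y_t = Y_t` by `ψ̃ ∘ σ̃ = id`). [folklore] -/
theorem mul_eval_sect (Bt : Fin (3 + 1) → Fin 3 → O) (Nt : Fin 3 → Fin 3 → O) (r : Fin 3 → Fin (3 + 1)) (nO : Fin 3 → O)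
    (av : Fin (3 + 1) → O) (u : O) (huav : ∀ a', u * av a' = ∑ j : Fin 3, Bt a' j * nO j)
    (hsect : ∀ G : MvPolynomial (Fin 3) O, aeval (fun a' : Fin (3 + 1) => ∑ j : Fin 3, C (Bt a' j) * X j) (aeval (fun i : Fin 3 => ∑ j : Fin 3, C (Nt i j) * X (r j)) G) = G) (t : Fin 3) :
    u * MvPolynomial.eval av (∑ j : Fin 3, C (Nt t j) * X (r j) : MvPolynomial (Fin (3 + 1)) O) = nO t := by
  have h := pow_mul_eval_eq_eval_aeval Bt nO av u huav (∑ j : Fin 3, C (Nt t j) * X (r j) : MvPolynomial (Fin (3 + 1)) O)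
    ((mem_homogeneousSubmodule _ _).mpr (HyperplaneAlg.isHomogeneous_sum_C_mul_X _ _))
  rw [pow_one] at h
  rw [h]
  have hs : ((∑ j : Fin 3, C (Nt t j) * X (r j) : MvPolynomial (Fin (3 + 1)) O)) = aeval (fun i : Fin 3 => ∑ j : Fin 3, C (Nt i j) * X (r j)) (X t : MvPolynomial (Fin 3) O) := by rw [aeval_X]
  rw [hs, hsect, eval_X]

/-- ★ **THE LINEAR FRAME AT A NODE SECTION.**  In `O[x₀..x₃]` (`O` a domain): the ideal `(x_j − a_j x_d)_j` of the `O`-point `a` (`a d = 1`,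
`u · a = B̃ · n`, `u` a unit, `n₂ = 1`) equals the ideal spanned by the frame `L̃`, `y₀ − n₀ y₂`, `y₁ − n₁ y₂`.  Hypotheses are `cores₂` binders
(`ct a₀ = 1`, `ψ̃ L̃ = 0`, `ψ̃ ∘ σ̃ = id`, `ker ψ̃ ⊆ (L̃)`).  See the module docstring for the proof. [folklore linear algebra] -/
theorem span_X_sub_eq_span_frame [IsDomain O] (Bt : Fin (3 + 1) → Fin 3 → O) (ct : Fin (3 + 1) → O) (Nt : Fin 3 → Fin 3 → O)
    (r : Fin 3 → Fin (3 + 1)) (a₀ : Fin (3 + 1)) (hcta₀ : ct a₀ = 1)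
    (hψt : aeval (fun a' : Fin (3 + 1) => ∑ j : Fin 3, C (Bt a' j) * X j) (∑ a, C (ct a) * X a : MvPolynomial (Fin (3 + 1)) O) = 0)
    (hsect : ∀ G : MvPolynomial (Fin 3) O, aeval (fun a' : Fin (3 + 1) => ∑ j : Fin 3, C (Bt a' j) * X j) (aeval (fun i : Fin 3 => ∑ j : Fin 3, C (Nt i j) * X (r j)) G) = G)
    (hkert : ∀ f : MvPolynomial (Fin (3 + 1)) O, aeval (fun a' : Fin (3 + 1) => ∑ j : Fin 3, C (Bt a' j) * X j) f = 0 → (∑ a, C (ct a) * X a : MvPolynomial (Fin (3 + 1)) O) ∣ f)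
    (nO : Fin 3 → O) (hn2 : nO 2 = 1) (av : Fin (3 + 1) → O) (d : Fin (3 + 1)) (hav : av d = 1) (u : O) (hu : IsUnit u)
    (huav : ∀ a', u * av a' = ∑ j : Fin 3, Bt a' j * nO j) :
    Ideal.span (Set.range fun j : Fin (3 + 1) => (X j - C (av j) * X d : MvPolynomial (Fin (3 + 1)) O)) =
      Ideal.span (Set.range ![(∑ a, C (ct a) * X a : MvPolynomial (Fin (3 + 1)) O),
        ((∑ j : Fin 3, C (Nt 0 j) * X (r j) : MvPolynomial (Fin (3 + 1)) O) - C (nO 0) * (∑ j : Fin 3, C (Nt 2 j) * X (r j) : MvPolynomial (Fin (3 + 1)) O)),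
        ((∑ j : Fin 3, C (Nt 1 j) * X (r j) : MvPolynomial (Fin (3 + 1)) O) - C (nO 1) * (∑ j : Fin 3, C (Nt 2 j) * X (r j) : MvPolynomial (Fin (3 + 1)) O))]) := by
  classical
  -- evaluations along the section
  have hLa : MvPolynomial.eval av (∑ a, C (ct a) * X a : MvPolynomial (Fin (3 + 1)) O) = 0 := by
    have h := pow_mul_eval_eq_eval_aeval Bt nO av u huav (∑ a, C (ct a) * X a : MvPolynomial (Fin (3 + 1)) O)
      ((mem_homogeneousSubmodule _ _).mpr (HyperplaneAlg.isHomogeneous_sum_C_mul_X _ _))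
    rw [pow_one, hψt, map_zero] at h
    exact hu.mul_right_eq_zero.mp h
  have hy := mul_eval_sect Bt Nt r nO av u huav hsect
  have hma : ∀ t : Fin 3, MvPolynomial.eval av ((∑ j : Fin 3, C (Nt t j) * X (r j) : MvPolynomial (Fin (3 + 1)) O) - C (nO t) * (∑ j : Fin 3, C (Nt 2 j) * X (r j) : MvPolynomial (Fin (3 + 1)) O)) = 0 := by
    intro t
    apply hu.mul_right_eq_zero.mp
    rw [map_sub, map_mul, eval_C, mul_sub, hy t, mul_left_comm, hy 2, hn2, mul_one, sub_self]
  -- the frame forms as `Σ c_j x_(r j)`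
  have hmform : ∀ t : Fin 3, ((∑ j : Fin 3, C (Nt t j) * X (r j) : MvPolynomial (Fin (3 + 1)) O) - C (nO t) * (∑ j : Fin 3, C (Nt 2 j) * X (r j) : MvPolynomial (Fin (3 + 1)) O)) =
      ∑ j : Fin 3, C (Nt t j - nO t * Nt 2 j) * X (r j) := by
    intro t
    rw [Finset.mul_sum, ← Finset.sum_sub_distrib]
    refine Finset.sum_congr rfl fun j _ => ?_
    rw [map_sub, map_mul]; ring
  have heval_form : ∀ (c : Fin 3 → O), MvPolynomial.eval av (∑ j : Fin 3, C (c j) * X (r j) : MvPolynomial (Fin (3 + 1)) O) = ∑ j, c j * av (r j) := by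
    intro c; simp [map_sum, eval_X]
  have heval_L : MvPolynomial.eval av (∑ a, C (ct a) * X a : MvPolynomial (Fin (3 + 1)) O) = ∑ a, ct a * av a := by simp [map_sum, eval_X]
  apply le_antisymm
  · -- `⊆`: each `x_j − a_j x_d` is `α L̃ + β m₀ + γ m₁`
    rw [Ideal.span_le]
    rintro _ ⟨j, rfl⟩
    set Lt := (∑ a, C (ct a) * X a : MvPolynomial (Fin (3 + 1)) O) with hLt
    set m0 := ((∑ j : Fin 3, C (Nt 0 j) * X (r j) : MvPolynomial (Fin (3 + 1)) O) - C (nO 0) * (∑ j : Fin 3, C (Nt 2 j) * X (r j) : MvPolynomial (Fin (3 + 1)) O)) with hm0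
    set m1 := ((∑ j : Fin 3, C (Nt 1 j) * X (r j) : MvPolynomial (Fin (3 + 1)) O) - C (nO 1) * (∑ j : Fin 3, C (Nt 2 j) * X (r j) : MvPolynomial (Fin (3 + 1)) O)) with hm1
    set ψ := aeval (R := O) (fun a' : Fin (3 + 1) => ∑ j : Fin 3, C (Bt a' j) * X j) with hψ
    -- the coefficients of `ψ (x_j − a_j x_d)` in `Y`
    set c' : Fin 3 → O := fun t => Bt j t - av j * Bt d t with hc'
    have hψX : ∀ a' : Fin (3 + 1), ψ (X a') = ∑ j' : Fin 3, C (Bt a' j') * X j' := fun a' => by rw [hψ, aeval_X]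
    have hψC : ∀ c : O, ψ (C c) = C c := fun c => by rw [hψ, aeval_C, algebraMap_eq]
    have hψm : ψ (X j - C (av j) * X d) = ∑ t : Fin 3, C (c' t) * X t := by
      rw [map_sub, map_mul, hψC, hψX, hψX, Finset.mul_sum, ← Finset.sum_sub_distrib]
      refine Finset.sum_congr rfl fun t _ => ?_
      rw [hc', map_sub, map_mul]; ring
    -- `Σ_t c'_t n_t = u a_j − a_j u a_d = 0`
    have hc'n : ∑ t : Fin 3, c' t * nO t = 0 := by
      have h1 : ∑ t : Fin 3, c' t * nO t = (∑ t : Fin 3, Bt j t * nO t) - av j * ∑ t : Fin 3, Bt d t * nO t := by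
        rw [Finset.mul_sum, ← Finset.sum_sub_distrib]
        refine Finset.sum_congr rfl fun t _ => ?_
        rw [hc']; ring
      rw [h1, ← huav j, ← huav d, hav]; ring
    -- the `Y`-frame: a linear form in `Y` vanishing at `n` (`n₂ = 1`) is a combination of `Y₀ − n₀Y₂`, `Y₁ − n₁Y₂`
    have hYdec : (∑ t : Fin 3, C (c' t) * X t : MvPolynomial (Fin 3) O) =
        C (c' 0) * (X 0 - C (nO 0) * X 2) + C (c' 1) * (X 1 - C (nO 1) * X 2) := by
      have h2 : c' 2 = -(c' 0 * nO 0 + c' 1 * nO 1) := by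
        have h := hc'n
        rw [Fin.sum_univ_three, hn2, mul_one] at h
        linear_combination h
      rw [Fin.sum_univ_three, h2, map_neg, map_add, map_mul, map_mul]
      ring
    -- `ψ m₀ = Y₀ − n₀ Y₂`, `ψ m₁ = Y₁ − n₁ Y₂` (by `ψ̃ ∘ σ̃ = id`)
    have hσ : ∀ t : Fin 3, (∑ j : Fin 3, C (Nt t j) * X (r j) : MvPolynomial (Fin (3 + 1)) O) = aeval (fun i : Fin 3 => ∑ j : Fin 3, C (Nt i j) * X (r j)) (X t : MvPolynomial (Fin 3) O) :=
      fun t => by rw [aeval_X]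
    have hψmt : ∀ t : Fin 3, ψ ((∑ j : Fin 3, C (Nt t j) * X (r j) : MvPolynomial (Fin (3 + 1)) O) - C (nO t) * (∑ j : Fin 3, C (Nt 2 j) * X (r j) : MvPolynomial (Fin (3 + 1)) O)) = X t - C (nO t) * X 2 := by
      intro t
      have hpre : ((∑ j : Fin 3, C (Nt t j) * X (r j) : MvPolynomial (Fin (3 + 1)) O) - C (nO t) * (∑ j : Fin 3, C (Nt 2 j) * X (r j) : MvPolynomial (Fin (3 + 1)) O)) = aeval (fun i : Fin 3 => ∑ j : Fin 3, C (Nt i j) * X (r j)) (X t - C (nO t) * X 2 : MvPolynomial (Fin 3) O) := by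
        rw [map_sub, map_mul, aeval_C, algebraMap_eq, ← hσ, ← hσ]
      rw [hpre, hsect]
    -- `T := m − β m₀ − γ m₁` is killed by `ψ`, hence divisible by `L̃`
    have hT : ψ (X j - C (av j) * X d - C (c' 0) * m0 - C (c' 1) * m1) = 0 := by
      rw [map_sub, map_sub, hψm, hYdec, map_mul, map_mul, hψC, hψC, hm0, hm1, hψmt 0, hψmt 1]
      ring
    obtain ⟨q, hq⟩ := hkert _ hT
    -- remove the `L̃`-component read off at `x_{a₀}` and conclude by the domain lemma
    set T := X j - C (av j) * X d - C (c' 0) * m0 - C (c' 1) * m1 with hTdef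
    set α := coeff (Finsupp.single a₀ 1) T with hα
    have hLhom : Lt.IsHomogeneous 1 := by
      rw [hLt]; exact HyperplaneAlg.isHomogeneous_sum_C_mul_X ct id
    have hyhom : ∀ t : Fin 3, ((∑ j : Fin 3, C (Nt t j) * X (r j) : MvPolynomial (Fin (3 + 1)) O)).IsHomogeneous 1 := fun t => HyperplaneAlg.isHomogeneous_sum_C_mul_X _ _
    have hThom : T.IsHomogeneous 1 := by
      rw [hTdef, hm0, hm1]
      exact (((isHomogeneous_X O j).sub ((isHomogeneous_X O d).C_mul (av j))).sub
        (((hyhom 0).sub ((hyhom 2).C_mul (nO 0))).C_mul (c' 0))).sub (((hyhom 1).sub ((hyhom 2).C_mul (nO 1))).C_mul (c' 1))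
    have hLa₀ : coeff (Finsupp.single a₀ 1) Lt = 1 := by rw [hLt, HyperplaneLift.coeff_single_sum_C_mul_X, hcta₀]
    have hT'a₀ : coeff (Finsupp.single a₀ 1) (T - C α * Lt) = 0 := by
      rw [coeff_sub, coeff_C_mul, hLa₀, mul_one, ← hα, sub_self]
    have hT'dvd : Lt ∣ T - C α * Lt := Dvd.dvd.sub ⟨q, hq⟩ (Dvd.intro_left _ rfl)
    have hT'0 : T - C α * Lt = 0 :=
      HyperplaneLift.eq_zero_of_dvd_of_isHomogeneous_one hLhom (by rw [hLa₀]; exact one_ne_zero) (hThom.sub (hLhom.C_mul α)) hT'a₀ hT'dvd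
    have hdec : (X j - C (av j) * X d : MvPolynomial (Fin (3 + 1)) O) = C α * Lt + C (c' 0) * m0 + C (c' 1) * m1 := by
      linear_combination hT'0 - hTdef
    show (X j - C (av j) * X d : MvPolynomial (Fin (3 + 1)) O) ∈ Ideal.span _
    rw [hdec]
    refine Ideal.add_mem _ (Ideal.add_mem _ (Ideal.mul_mem_left _ _ (Ideal.subset_span ⟨0, rfl⟩))
      (Ideal.mul_mem_left _ _ (Ideal.subset_span ⟨1, rfl⟩))) (Ideal.mul_mem_left _ _ (Ideal.subset_span ⟨2, rfl⟩))
  · -- `⊇`: the three frame forms vanish at `a`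
    rw [Ideal.span_le]
    rintro _ ⟨l, rfl⟩
    fin_cases l
    · simpa using sum_C_mul_X_mem_span_of_eval ct id av d (by show ∑ i, ct i * av i = 0; rw [← heval_L]; exact hLa)
    · have h := sum_C_mul_X_mem_span_of_eval (fun j => Nt 0 j - nO 0 * Nt 2 j) r av d (by rw [← heval_form, ← hmform]; exact hma 0)
      simpa [hmform] using h
    · have h := sum_C_mul_X_mem_span_of_eval (fun j => Nt 1 j - nO 1 * Nt 2 j) r av d (by rw [← heval_form, ← hmform]; exact hma 1)
      simpa [hmform] using h

end Summit.ResolutionOfSingularities.ResolutionOfSingularities.Cruxes.EquisingularLiftNat.Sections.Equinodal.SectionFrame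

end
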